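import Summits.HubbardSuperconductivity.HubbardSuperconductivity.Theorems.WidthHaldaneTubeEtaPairing

/-!
# The pair steps of the even Hubbard tubes at the cruxes' filling are at most `U`; the `η`-tower cap

Companion of `WidthHaldaneTubeEtaPairing` (Yang's `η`-pairing bound
`E_{L,M}(U; θ, 2n+2) ≤ E_{L,M}(U; θ, 2n) + U`, `L`, `M` even, `2n < LM`, `e^{iθ} = e^{-iθ}`),
specialised to the filling `N = N_{L,M}(δ) = 2⌊(1-δ)LM/2⌋` of the cruxes over `WidthHaldaneDefs` (items
stmt-HubbardSuperconductivity-16312 `WidthUniformThermodynamics`, 18510 `PerWidthThermodynamics`,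
18509 `SeamGluingLocality`, 16311 `WidthHaldaneBridge`), whose conjunct (ii) is
`0 < ẽ″_{L,M} ≤ k₀`, `ẽ″_{L,M} = LM[(E(N+2) - E(N)) - (E(N) - E(N-2))]/4`. All PROVED, no definition,
no named fact:

* `tubeH_mulVec_vacuum`, `tubeEnergy_vacuumSector` — the twisted tube kills the vacuum; `E(U; θ, 0) = 0`;
* `tubeEnergy_le_eta_tower` — `E_{L,M}(U; θ, 2n) ≤ n·U` for `2n ≤ LM` (Yang's `η`-tower caps every even
  sector; a-priori `E(N) ≤ UN/2` at every filling below and up to half filling);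
* `tubeFilling_lt` — `N_{L,M}(δ) < LM` for `δ > 0` (strictly below half filling);
* `tubeEnergy_tubeFilling_add_two_le`, `tubeEnergy_tubeFilling_le_sub_two_add` — both pair steps at
  the filling are `≤ U` (physically: `2μ ≤ U` below half filling on a bipartite lattice);
* `tubePairCompressibility_le_of_eta` — hence `ẽ″_{L,M} ≤ (LM/4)(U - [E(N) - E(N-2)])`. The
  `η`-symmetry controls the FORWARD step only: this would give the cruxes' ceiling `ẽ″ ≤ k₀` only
  where the backward step is within `4k₀/(LM)` of `U` (the Mott edge), so in the doped regime
  conjunct (ii) is untouched by it in either direction — recorded so that no line spends a stub on it;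
* `uniformThermo_pairSteps` — what it does say under the hypothesis `UniformThermo` of 16311/16312:
  `E(N) - E(N-2) < E(N+2) - E(N) ≤ U` at every admissible size.

References: C. N. Yang, PRL 63 (1989) 2144, eqs. (6)–(7); C. N. Yang, S. C. Zhang, Mod. Phys. Lett.
B 4 (1990) 759, Theorem 1.
-/

noncomputable section

namespace Summit.HubbardSuperconductivity.HubbardSuperconductivity.Theorems.WidthHaldane

set_option linter.dupNamespace false -- summit = problem name (single-conjunct summit), D-0017

open scoped BigOperators Classical Matrix ComplexConjugate ComplexOrder
open Matrix Literature.MathematicalPhysics.QuantumLattice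

section Filling

variable (L M : ℕ) [NeZero L] [NeZero M] (Λ : Type) [LinearOrder Λ] [Fintype Λ]
  (e : Λ ≃ ZMod L × ZMod M)

/-! ### The vacuum sector and the `η`-tower cap -/

/-- The (twisted) tube Hamiltonian annihilates the vacuum: every term ends in an annihilation
operator (`hamiltonian_mulVec_vacuum` for the pure tube; the seam terms likewise). [folklore] -/
theorem tubeH_mulVec_vacuum (U θ : ℝ) :
    (tubeH0 L M Λ e U + tubeTwist L M Λ e θ) *ᵥ (vacuum : Fock (Orb Λ)) = 0 := by
  have h0 : tubeH0 L M Λ e U *ᵥ (vacuum : Fock (Orb Λ)) = 0 :=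
    hamiltonian_mulVec_vacuum (tubeGraph e) 1 U
  have han : ∀ (A : Matrix (Finset (Orb Λ)) (Finset (Orb Λ)) ℂ) (i : Orb Λ),
      (A * annihilation i) *ᵥ (vacuum : Fock (Orb Λ)) = 0 := fun A i => by
    rw [← mulVec_mulVec, annihilation_mulVec_vacuum_holds, mulVec_zero]
  have hT : tubeTwist L M Λ e θ *ᵥ (vacuum : Fock (Orb Λ)) = 0 := by
    unfold tubeTwist
    simp only [sum_mulVec, add_mulVec, smul_mulVec, han, smul_zero, add_zero,
      Finset.sum_const_zero]
  rw [add_mulVec, h0, hT, add_zero]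

/-- **The empty sector has energy `0`**: `E_{L,M}(U; θ, 0) = 0` — the sector `(0, S^z = 0)` is
spanned by the vacuum, which the twisted tube annihilates. [folklore] -/
theorem tubeEnergy_vacuumSector (U θ : ℝ) : tubeEnergy L M Λ e U θ 0 = 0 := by
  rw [tubeEnergy_eq]
  have hmul : ∀ ψ ∈ szSector 0 (0 : ℝ), ψ = ψ ∅ • (vacuum : Fock (Orb Λ)) := by
    intro ψ hψ
    have hN : IsNParticle 0 ψ := ((mem_szSector_iff 0 0 ψ).1 hψ).1
    funext s
    rw [Pi.smul_apply, vacuum, Pi.single_apply, smul_eq_mul]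
    by_cases hs : s = ∅
    · subst hs; rw [if_pos rfl, mul_one]
    · rw [if_neg hs, mul_zero, hN s (fun h => hs (Finset.card_eq_zero.1 h))]
  have hray : ∀ ψ ∈ szSector 0 (0 : ℝ),
      (star ψ ⬝ᵥ (tubeH0 L M Λ e U + tubeTwist L M Λ e θ) *ᵥ ψ).re = 0 := by
    intro ψ hψ
    rw [hmul ψ hψ, mulVec_smul, tubeH_mulVec_vacuum, smul_zero, dotProduct_zero, Complex.zero_re]
  have hIn : IsInSector 0 0 (vacuum : Fock (Orb Λ)) := by
    intro s hs
    rw [vacuum, Pi.single_apply, if_neg]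
    rintro rfl
    exact hs ⟨by simp [upPart], by simp [downPart]⟩
  have hvac : (vacuum : Fock (Orb Λ)) ∈ szSector 0 (0 : ℝ) :=
    (mem_szSector_two_mul_zero_iff 0 _).2 hIn
  have h1 : star (vacuum : Fock (Orb Λ)) ⬝ᵥ vacuum = 1 := by
    simp [vacuum, dotProduct, Pi.single_apply]
  unfold Matrix.minEnergyOn
  have hset : {E : ℝ | ∃ ψ ∈ szSector 0 (0 : ℝ), star ψ ⬝ᵥ ψ = 1 ∧
      E = (star ψ ⬝ᵥ (tubeH0 L M Λ e U + tubeTwist L M Λ e θ) *ᵥ ψ).re} = {0} := by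
    ext E
    simp only [Set.mem_setOf_eq, Set.mem_singleton_iff]
    constructor
    · rintro ⟨ψ, hψ, -, rfl⟩
      exact hray ψ hψ
    · rintro rfl
      exact ⟨vacuum, hvac, h1, (hray _ hvac).symm⟩
  rw [hset, csInf_singleton]

/-- **Yang's `η`-tower caps every even sector**: for `L`, `M` even, `e^{iθ} = e^{-iθ}` and
`2n ≤ LM`, `E_{L,M}(U; θ, 2n) ≤ n·U` (the `η`-paired state `(η†)ⁿ|0⟩` is an exact eigenvector of the
`(2n, S^z = 0)` sector at energy `nU`; here by induction from the empty sector with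
`tubeEnergy_add_two_le`). Yang, PRL 63 (1989) 2144, eq. (7). [cite: Yang1989, eq. (7)] -/
theorem tubeEnergy_le_eta_tower (hL : Even L) (hM : Even M) (U θ : ℝ)
    (hθ : Complex.exp (Complex.I * θ) = Complex.exp (-(Complex.I * θ))) {n : ℕ}
    (hn : 2 * n ≤ L * M) : tubeEnergy L M Λ e U θ (2 * n) ≤ n * U := by
  induction n with
  | zero => simp [tubeEnergy_vacuumSector]
  | succ k ih =>
    have h1 := ih (by omega)
    have h2 := tubeEnergy_add_two_le L M Λ e hL hM U θ hθ (n := k) (by omega)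
    have h3 : 2 * (k + 1) = 2 * k + 2 := by ring
    rw [h3]
    push_cast
    linarith

/-! ### At the cruxes' filling `N_{L,M}(δ) = 2⌊(1-δ)LM/2⌋` -/

omit [NeZero L] [NeZero M] in
/-- Below half filling: `N_{L,M}(δ) < LM` for `δ > 0` (and `LM > 0`). [folklore] -/
theorem tubeFilling_lt (hLM : 0 < L * M) {δ : ℝ} (hδ : 0 < δ) : tubeFilling L M δ < L * M := by
  unfold tubeFilling
  have hLMr : (0 : ℝ) < (L : ℝ) * M := by exact_mod_cast hLM
  by_cases h : (1 - δ) * ((L : ℝ) * M) / 2 ≤ 0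
  · rw [Nat.floor_of_nonpos h, mul_zero]
    exact hLM
  · push Not at h
    have hfloor : (⌊(1 - δ) * ((L : ℝ) * M) / 2⌋₊ : ℝ) ≤ (1 - δ) * ((L : ℝ) * M) / 2 :=
      Nat.floor_le h.le
    have key : ((2 * ⌊(1 - δ) * ((L : ℝ) * M) / 2⌋₊ : ℕ) : ℝ) < (L : ℝ) * M := by
      push_cast
      nlinarith
    exact_mod_cast key


/-- **Forward pair step at the cruxes' filling is at most `U`**: for `L`, `M` even, `δ > 0`, every
`U` and every labelling, `E_{L,M}(U; 0, N_{L,M}(δ) + 2) ≤ E_{L,M}(U; 0, N_{L,M}(δ)) + U`.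
[cite: Yang1989, eq. (6)] -/
theorem tubeEnergy_tubeFilling_add_two_le (hL : Even L) (hM : Even M) (U : ℝ) {δ : ℝ}
    (hδ : 0 < δ) :
    tubeEnergy L M Λ e U 0 (tubeFilling L M δ + 2) ≤ tubeEnergy L M Λ e U 0 (tubeFilling L M δ) + U := by
  have hLM : 0 < L * M := Nat.pos_of_ne_zero (mul_ne_zero (NeZero.ne L) (NeZero.ne M))
  have hlt := tubeFilling_lt L M hLM hδ
  unfold tubeFilling at hlt ⊢
  exact tubeEnergy_zero_add_two_le L M Λ e hL hM U hlt

/-- **Backward pair step at the cruxes' filling is at most `U`** (`U ≥ 0` covers the degenerate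
size `N_{L,M}(δ) = 0`, where the truncated subtraction makes both sides `E(0)`): for `L`, `M` even,
`δ > 0`, every labelling, `E_{L,M}(U; 0, N_{L,M}(δ)) ≤ E_{L,M}(U; 0, N_{L,M}(δ) - 2) + U`.
[cite: Yang1989, eq. (6)] -/
theorem tubeEnergy_tubeFilling_le_sub_two_add (hL : Even L) (hM : Even M) {U : ℝ} (hU : 0 ≤ U)
    {δ : ℝ} (hδ : 0 < δ) :
    tubeEnergy L M Λ e U 0 (tubeFilling L M δ) ≤ tubeEnergy L M Λ e U 0 (tubeFilling L M δ - 2) + U := by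
  have hLM : 0 < L * M := Nat.pos_of_ne_zero (mul_ne_zero (NeZero.ne L) (NeZero.ne M))
  have hlt := tubeFilling_lt L M hLM hδ
  unfold tubeFilling at hlt ⊢
  rcases Nat.eq_zero_or_pos ⌊(1 - δ) * ((L : ℝ) * (M : ℝ)) / 2⌋₊ with h0 | hpos
  · rw [h0]
    simpa using hU
  · obtain ⟨j, hj⟩ : ∃ j, ⌊(1 - δ) * ((L : ℝ) * (M : ℝ)) / 2⌋₊ = j + 1 := ⟨_, (Nat.succ_pred_eq_of_pos hpos).symm⟩
    rw [hj] at hlt ⊢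
    have h2 : 2 * (j + 1) - 2 = 2 * j := by omega
    have h3 : 2 * (j + 1) = 2 * j + 2 := by ring
    rw [h2, h3]
    exact tubeEnergy_zero_add_two_le L M Λ e hL hM U (by omega)

/-- **`η`-pairing and the inverse pair compressibility**: for `L`, `M` even, `δ > 0`, every `U`
and every labelling, `ẽ″_{L,M}(U,δ) ≤ (LM/4)·(U - [E(N) - E(N-2)])`, `N = N_{L,M}(δ)` — the forward
pair step in `ẽ″ = LM[(E(N+2) - E(N)) - (E(N) - E(N-2))]/4` is at most `U`. (One-sided and `O(LM)`:
it is NOT a width-uniform ceiling; see the module docstring.) [cite: Yang1989, eq. (6)] -/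
theorem tubePairCompressibility_le_of_eta (hL : Even L) (hM : Even M) (U : ℝ) {δ : ℝ}
    (hδ : 0 < δ) :
    tubePairCompressibility L M Λ e U δ ≤
      (L : ℝ) * (M : ℝ) / 4 *
        (U - (tubeEnergy L M Λ e U 0 (tubeFilling L M δ) -
          tubeEnergy L M Λ e U 0 (tubeFilling L M δ - 2))) := by
  have h := tubeEnergy_tubeFilling_add_two_le L M Λ e hL hM U hδ
  have hLM : (0 : ℝ) ≤ (L : ℝ) * (M : ℝ) := by positivity
  rw [tubePairCompressibility_eq]
  nlinarith [mul_le_mul_of_nonneg_left h hLM]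


/-- **What the `η`-symmetry says about the cruxes' hypothesis.** Under the width-uniform
thermodynamic hypothesis `UniformThermo U δ d₀ k₀ M₁ L₀` (the matrix of `WidthUniformThermodynamics`,
stmt-16312, and the hypothesis of `WidthHaldaneBridge`, stmt-16311) with `δ > 0`, at every admissible
size and labelling the two pair steps at the filling `N = N_{L,M}(δ)` are STRICTLY INCREASING (this is
`0 < ẽ″`) and the forward one is CAPPED BY `U` (this is `η`-pairing):
`E(N) - E(N-2) < E(N+2) - E(N) ≤ U`. [cite: Yang1989, eq. (6)] -/
theorem uniformThermo_pairSteps {U δ d₀ k₀ : ℝ} {M₁ L₀ : ℕ} (hδ : 0 < δ)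
    (h : UniformThermo U δ d₀ k₀ M₁ L₀) (L M : ℕ) [NeZero L] [NeZero M] (hLe : Even L)
    (hMe : Even M) (hM : M₁ ≤ M) (hML : M ≤ L) (hL : L₀ ≤ L) (Λ : Type) [LinearOrder Λ] [Fintype Λ]
    (e : Λ ≃ ZMod L × ZMod M) :
    tubeEnergy L M Λ e U 0 (tubeFilling L M δ) - tubeEnergy L M Λ e U 0 (tubeFilling L M δ - 2) <
        tubeEnergy L M Λ e U 0 (tubeFilling L M δ + 2) - tubeEnergy L M Λ e U 0 (tubeFilling L M δ) ∧
      tubeEnergy L M Λ e U 0 (tubeFilling L M δ + 2) - tubeEnergy L M Λ e U 0 (tubeFilling L M δ) ≤ U := by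
  refine ⟨?_, by linarith [tubeEnergy_tubeFilling_add_two_le L M Λ e hLe hMe U hδ]⟩
  have hpos := (h L M hLe hMe hM hML hL Λ e).2.1
  rw [tubePairCompressibility_eq] at hpos
  have hLM : (0 : ℝ) < (L : ℝ) * (M : ℝ) := by
    have : 0 < L * M := Nat.pos_of_ne_zero (mul_ne_zero (NeZero.ne L) (NeZero.ne M))
    exact_mod_cast this
  have key : 0 < tubeEnergy L M Λ e U 0 (tubeFilling L M δ + 2) +
      tubeEnergy L M Λ e U 0 (tubeFilling L M δ - 2) - 2 * tubeEnergy L M Λ e U 0 (tubeFilling L M δ) := by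
    by_contra hneg
    push Not at hneg
    have : (L : ℝ) * (M : ℝ) * (tubeEnergy L M Λ e U 0 (tubeFilling L M δ + 2) +
        tubeEnergy L M Λ e U 0 (tubeFilling L M δ - 2) - 2 * tubeEnergy L M Λ e U 0 (tubeFilling L M δ)) / 4 ≤ 0 :=
      div_nonpos_of_nonpos_of_nonneg (mul_nonpos_of_nonneg_of_nonpos hLM.le hneg) (by norm_num)
    linarith
  linarith

end Filling

end Summit.HubbardSuperconductivity.HubbardSuperconductivity.Theorems.WidthHaldane

end
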